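import Summits.CriticalPhenomena.PercolationContinuityZ3.Theorems.PercNearOneGluingNoHeavyLowerTailConditionalThreePointAG
import HarnessLib

/-!
# `NoHeavyLowerTail` (stmt-CriticalPhenomena-4575), four-point law: the conditional Aas–Gladkov inequality given an isolated VERTEX SET

Support file (prover seat `prim-l12-p2`, gen 4; `--supports stmt-CriticalPhenomena-4575`).  Proofs only, standard axioms; companion of
`…ConditionalThreePointAG` (the case of one isolated vertex `T = {d}`, Gladkov–Zimin draft 2024 Cor. 3.5), whose kernel lemma `m3_kernel_ineq`
(Gladkov–Zimin Thm 2.3 with the `M₃` certificate kernel, for every monotone image of a product measure) is reused verbatim.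

STATEMENT (`condAG_isolatedSet_lab`).  Bond percolation `μ = prodBernoulli w`, arbitrary edge probabilities, finite vertex type; vertices `a, b, c` and ANY
vertex set `T`; `D_T = {ω | ∀ s ∈ {a,b,c}, ∀ t ∈ T, s ↮ t}` ("`T` is isolated from `a, b, c`"); `m_l = μ(D_T ∩ {lab3 a b c = l})` the five masses of the
partition of `{a,b,c}` on `D_T`.  Then `m_ab m_ac + m_ab m_bc + m_ac m_bc ≤ m_top m_bot` — Gladkov's three-point strong Harris–Kleitman inequality for
the law of the clusters of `a, b, c` restricted to `{T isolated}`.  van den Berg–Häggström–Kahn's Theorem 2.1 is stated for vertex SETS `S, T`, and the tree's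
transfer principle `BHK2006_twoSetConditional_transfer` likewise, so the proof of the one-vertex case goes through word for word; the transfer hypotheses are
removed by the closure principle in the weights and the degenerate case `T ∩ {a,b,c} ≠ ∅` (`D_T = ∅`).
Use: the conditional rows of `k`-point connectivity laws obtained by isolating any set of the other terminals (memo prim-l12/prim-l12-p2/FINDING-g4-MINORS26-CLASSIFIED.md §5).
[cite: GladkovZimin2024HK, Cor. 3.5 and §3.2]; [cite: VandenbergHaggstromKahn2005, Thm. 2.1 (p. 9), §2.1]
-/

noncomputable section

open MeasureTheory Set
open Literature.Probability.LatticeModels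
open Literature.Probability.Percolation

namespace Summit.CriticalPhenomena.PercolationContinuityZ3.Theorems.CutVertexMinors

open M3Lab
open scoped Classical

universe u

variable {V : Type u}

/-- Integral of a `0/1` function of a label. [folklore] -/
private theorem integral_ite_eq_real' {Ω : Type*} [MeasurableSpace Ω] [MeasurableSingletonClass Ω] [Fintype Ω]
    (μ : Measure Ω) [IsFiniteMeasure μ] (p : Ω → Prop) [DecidablePred p] :
    ∫ x, (if p x then (1 : ℝ) else 0) ∂μ = μ.real {x | p x} := by
  have h : (fun x => if p x then (1 : ℝ) else 0) = Set.indicator {x | p x} 1 := by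
    funext x
    by_cases hx : p x
    · rw [if_pos hx, Set.indicator_of_mem (show x ∈ {x | p x} from hx), Pi.one_apply]
    · rw [if_neg hx, Set.indicator_of_notMem (show x ∉ {x | p x} from hx)]
  rw [h, integral_indicator_one (MeasurableSet.of_discrete)]

/-- Reachability between points of `S` is the same in `ω` and in the union `C_S(ω)` of their open edge
clusters. [folklore] -/
private theorem reachable_setCl_iff' {S : Set V} {s v : V} (hs : s ∈ S) (ω : BondConfig V) :
    (openGraph (⋃ s ∈ S, openEdgeCluster ω s)).Reachable s v ↔ (openGraph ω).Reachable s v := by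
  constructor
  · intro h
    exact h.mono (BHK2006.openGraph_le (Set.iUnion₂_subset fun s _ => openEdgeCluster_subset ω s))
  · rintro ⟨p⟩
    have hp : ∀ e' ∈ p.edges, e' ∈ (openGraph (⋃ s ∈ S, openEdgeCluster ω s)).edgeSet := fun e' he' => by
      have h1 : e' ∈ openEdgeCluster ω s := TwoSetExchange.edge_mem_openEdgeCluster_of_walk p e' he'
      have h2 := ((mem_openEdgeCluster_iff ω s e').1 h1).2.1
      change e' ∈ (SimpleGraph.fromEdgeSet (⋃ s ∈ S, openEdgeCluster ω s)).edgeSet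
      rw [SimpleGraph.edgeSet_fromEdgeSet]
      exact ⟨Set.mem_biUnion hs h1, h2⟩
    exact ⟨p.transfer _ hp⟩

/-- The label of the true state `(C_S(ω), C_T(ω))`, `S = {a,b,c}`, is the label of `ω`. [this work] -/
private theorem lab3_setCl' (a b c : V) (ω : BondConfig V) :
    lab3 a b c (⋃ s ∈ ({a, b, c} : Set V), openEdgeCluster ω s) = lab3 a b c ω := by
  have ha : a ∈ ({a, b, c} : Set V) := mem_insert a {b, c}
  have hb : b ∈ ({a, b, c} : Set V) := mem_insert_of_mem a (mem_insert b {c})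
  unfold lab3
  simp only [reachable_setCl_iff' ha, reachable_setCl_iff' hb]

variable [Fintype V]

/-- **Conditional Aas–Gladkov inequality given an isolated vertex set** (label form).  For every weight function, vertices `a,b,c` and vertex set `T`,
with `D_T = {a,b,c ↮ T}` and `m_l = μ(D_T ∩ {lab3 a b c = l})`: `m_ab m_ac + m_ab m_bc + m_ac m_bc ≤ m_top m_bot`.
[cite: GladkovZimin2024HK, Cor. 3.5 and §3.2 — corollary, derived in this file] -/
theorem condAG_isolatedSet_lab (w : Sym2 V → unitInterval) (a b c : V) (T : Set V) :
    (prodBernoulli w).real ({ω : BondConfig V | ∀ s ∈ ({a, b, c} : Set V), ∀ t ∈ T,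
        ¬ (openGraph ω).Reachable s t} ∩ {ω | lab3 a b c ω = M3Lab.ab}) *
      (prodBernoulli w).real ({ω : BondConfig V | ∀ s ∈ ({a, b, c} : Set V), ∀ t ∈ T,
        ¬ (openGraph ω).Reachable s t} ∩ {ω | lab3 a b c ω = M3Lab.ac}) +
    (prodBernoulli w).real ({ω : BondConfig V | ∀ s ∈ ({a, b, c} : Set V), ∀ t ∈ T,
        ¬ (openGraph ω).Reachable s t} ∩ {ω | lab3 a b c ω = M3Lab.ab}) *
      (prodBernoulli w).real ({ω : BondConfig V | ∀ s ∈ ({a, b, c} : Set V), ∀ t ∈ T,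
        ¬ (openGraph ω).Reachable s t} ∩ {ω | lab3 a b c ω = M3Lab.bc}) +
    (prodBernoulli w).real ({ω : BondConfig V | ∀ s ∈ ({a, b, c} : Set V), ∀ t ∈ T,
        ¬ (openGraph ω).Reachable s t} ∩ {ω | lab3 a b c ω = M3Lab.ac}) *
      (prodBernoulli w).real ({ω : BondConfig V | ∀ s ∈ ({a, b, c} : Set V), ∀ t ∈ T,
        ¬ (openGraph ω).Reachable s t} ∩ {ω | lab3 a b c ω = M3Lab.bc}) ≤
    (prodBernoulli w).real ({ω : BondConfig V | ∀ s ∈ ({a, b, c} : Set V), ∀ t ∈ T,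
        ¬ (openGraph ω).Reachable s t} ∩ {ω | lab3 a b c ω = M3Lab.top}) *
      (prodBernoulli w).real ({ω : BondConfig V | ∀ s ∈ ({a, b, c} : Set V), ∀ t ∈ T,
        ¬ (openGraph ω).Reachable s t} ∩ {ω | lab3 a b c ω = M3Lab.bot}) := by
  classical
  set D : Set (BondConfig V) := {ω | ∀ s ∈ ({a, b, c} : Set V), ∀ t ∈ T, ¬ (openGraph ω).Reachable s t} with hDdef
  by_cases hd : a ∈ T ∨ b ∈ T ∨ c ∈ T
  · -- degenerate: `D = ∅`
    have hDe : D = ∅ := by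
      refine Set.eq_empty_iff_forall_notMem.2 fun ω hω => ?_
      rcases hd with h | h | h
      · exact hω a (mem_insert a {b, c}) a h (SimpleGraph.Reachable.refl a)
      · exact hω b (mem_insert_of_mem a (mem_insert b {c})) b h (SimpleGraph.Reachable.refl b)
      · exact hω c (mem_insert_of_mem a (mem_insert_of_mem b (mem_singleton c))) c h (SimpleGraph.Reachable.refl c)
    simp only [hDe, empty_inter, measureReal_empty, mul_zero, add_zero, le_refl]
  simp only [not_or] at hd
  obtain ⟨hda, hdb, hdc⟩ := hd
  have hDne : D.Nonempty := by
    refine ⟨∅, fun s hs t ht hr => ?_⟩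
    have hbot : openGraph (∅ : BondConfig V) = ⊥ := SimpleGraph.fromEdgeSet_empty
    rw [hbot, SimpleGraph.reachable_bot] at hr
    subst hr
    rcases hs with rfl | rfl | rfl
    · exact hda ht
    · exact hdb ht
    · exact hdc ht
  refine weights_le_of_forall_pos_lt_one
    (f := fun p : Sym2 V → unitInterval =>
      (prodBernoulli p).real (D ∩ {ω | lab3 a b c ω = M3Lab.ab}) * (prodBernoulli p).real (D ∩ {ω | lab3 a b c ω = M3Lab.ac}) +
      (prodBernoulli p).real (D ∩ {ω | lab3 a b c ω = M3Lab.ab}) * (prodBernoulli p).real (D ∩ {ω | lab3 a b c ω = M3Lab.bc}) +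
      (prodBernoulli p).real (D ∩ {ω | lab3 a b c ω = M3Lab.ac}) * (prodBernoulli p).real (D ∩ {ω | lab3 a b c ω = M3Lab.bc}))
    (g := fun p : Sym2 V → unitInterval =>
      (prodBernoulli p).real (D ∩ {ω | lab3 a b c ω = M3Lab.top}) * (prodBernoulli p).real (D ∩ {ω | lab3 a b c ω = M3Lab.bot}))
    ?_ ?_ (fun p hp => ?_) w
  · have c2 := prodBernoulli_real_continuous (ι := Sym2 V) (D ∩ {ω | lab3 a b c ω = M3Lab.ab})
    have c3 := prodBernoulli_real_continuous (ι := Sym2 V) (D ∩ {ω | lab3 a b c ω = M3Lab.ac})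
    have c4 := prodBernoulli_real_continuous (ι := Sym2 V) (D ∩ {ω | lab3 a b c ω = M3Lab.bc})
    exact ((c2.mul c3).add (c2.mul c4)).add (c3.mul c4)
  · exact (prodBernoulli_real_continuous _).mul (prodBernoulli_real_continuous _)
  · have hT : ∀ e : Sym2 V, ¬ e.IsDiag → (∃ v ∈ e, v ∈ T) → (p e : ℝ) < 1 :=
      fun e _ _ => unitInterval.coe_lt_one.2 (hp e).2
    have hD : 0 < (prodBernoulli p).real D := prodBernoulli_real_pos_of_nonempty hp hDne
    -- the inequality `m0 m1 - (m2 m3 + m2 m4 + m3 m4) ≥ 0` transferred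
    have hP : Continuous fun m : Fin 5 → ℝ => m 0 * m 1 - (m 2 * m 3 + m 2 * m 4 + m 3 * m 4) := by continuity
    have key := BHK2006_twoSetConditional_transfer p ({a, b, c} : Set V) T hT hD
      ![fun x => if lab3 a b c x.1 = M3Lab.top then 1 else 0, fun x => if lab3 a b c x.1 = M3Lab.bot then 1 else 0,
        fun x => if lab3 a b c x.1 = M3Lab.ab then 1 else 0, fun x => if lab3 a b c x.1 = M3Lab.ac then 1 else 0,
        fun x => if lab3 a b c x.1 = M3Lab.bc then 1 else 0] hP
      fun β _ q g hg => by
        have hg1 : ∀ x x', x ⊆ x' → (g x).1 ⊆ (g x').1 := fun x x' h => (hg x x' h).1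
        have h := m3_kernel_ineq q a b c g hg1
        simp only [Matrix.cons_val_zero, Matrix.cons_val_one, Matrix.cons_val_two, Matrix.cons_val_three,
          Matrix.cons_val_four, Matrix.tail_cons, Matrix.head_cons, integral_ite_eq_real']
        linarith
    simp only [Matrix.cons_val_zero, Matrix.cons_val_one, Matrix.cons_val_two, Matrix.cons_val_three,
      Matrix.cons_val_four, Matrix.tail_cons, Matrix.head_cons, lab3_setCl'] at key
    -- the restricted integrals are the masses of `D ∩ {lab = l}`
    have hint : ∀ l : M3Lab, ∫ ω in D, (if lab3 a b c ω = l then (1 : ℝ) else 0) ∂(prodBernoulli p) =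
        (prodBernoulli p).real (D ∩ {ω | lab3 a b c ω = l}) := by
      intro l
      have h : (fun ω : BondConfig V => if lab3 a b c ω = l then (1 : ℝ) else 0) =
          Set.indicator {ω | lab3 a b c ω = l} 1 := by
        funext ω
        by_cases hω : lab3 a b c ω = l
        · rw [if_pos hω, Set.indicator_of_mem (show ω ∈ {ω | lab3 a b c ω = l} from hω), Pi.one_apply]
        · rw [if_neg hω, Set.indicator_of_notMem (show ω ∉ {ω | lab3 a b c ω = l} from hω)]
      rw [h, integral_indicator_one MeasurableSet.of_discrete, measureReal_restrict_apply MeasurableSet.of_discrete,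
        inter_comm]
    rw [← hDdef] at key
    simp only [hint] at key
    -- clear denominators
    set Z := (prodBernoulli p).real D with hZ
    set m0 := (prodBernoulli p).real (D ∩ {ω | lab3 a b c ω = M3Lab.top})
    set m1 := (prodBernoulli p).real (D ∩ {ω | lab3 a b c ω = M3Lab.bot})
    set m2 := (prodBernoulli p).real (D ∩ {ω | lab3 a b c ω = M3Lab.ab})
    set m3 := (prodBernoulli p).real (D ∩ {ω | lab3 a b c ω = M3Lab.ac})
    set m4 := (prodBernoulli p).real (D ∩ {ω | lab3 a b c ω = M3Lab.bc})
    have key' : 0 ≤ m0 / Z * (m1 / Z) - (m2 / Z * (m3 / Z) + m2 / Z * (m4 / Z) + m3 / Z * (m4 / Z)) := key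
    have hZ2 : 0 < Z * Z := mul_pos hD hD
    have e : m0 / Z * (m1 / Z) - (m2 / Z * (m3 / Z) + m2 / Z * (m4 / Z) + m3 / Z * (m4 / Z)) =
        (m0 * m1 - (m2 * m3 + m2 * m4 + m3 * m4)) / (Z * Z) := by
      field_simp
    rw [e] at key'
    have := (div_nonneg_iff.1 key').resolve_right (fun h => absurd h.2 (not_le.2 hZ2))
    linarith [this.1]


end Summit.CriticalPhenomena.PercolationContinuityZ3.Theorems.CutVertexMinors
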